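import Summits.Ventures.LatticeQCDFlow.Scaling.FiniteOddsLaw
import Summits.Ventures.LatticeQCDFlow.Scaling.StarCycleCertificateLaw

/-!
HONEST FRAMING: exact (Metropolis-corrected) sampling algorithms for lattice gauge theory; figures
of merit are autocorrelation/cost numbers at stated couplings and volumes; no continuum-physics
claim.

# FiniteOddsMixingTime — THE MIXING TIME OF THE LUMPED STAR AT SWAP ODDS `σ`: `t_mix(ε) ≤ ⌈((2K+2)/(σ·p̄))·log(((K+1)(4K+4) + 2(K+1)(4K+8))/ε)⌉` REFRESH CYCLES,
# `p̄ = pE_{μ_0}[Wθ]` — ORDER `(K/(σp̄))·log(K/ε)` AT EVERY SWAP RATE, ONE POTENTIAL FOR ALL SWAP RATES (lean-2 GEN-38, ours)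

Venture-side (OURS).  Cell `lqcd-flow` (pub-lqcd), unit `pub-lqcd-lean-2-g38`, 2026-08-30.  Chapter W (item 1 (i) at finite swap odds), file 28 = the mixing-time form of file 27
(`finiteOdds_worstTvDist_le`, the law at every swap rate, unconditional) at the potential constant `c = 2K+2` and the rate `ρ = σp̄/(2K+2)`, `p̄ = pE_{μ_0}[Wθ]` (`ρ ≤ ½` because
`pWθ = pW/(1+pW) ≤ ½`): `d(n) ≤ C(1−ρ)ⁿ ≤ Ce^{−ρn} ≤ ε` for `n ≥ (1/ρ)log(C/ε)`, `C = (K+1)(4K+4) + 2(K+1)(4K+8)`.  Hypothesis-equations, no definitions.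

## What is proved

* `finiteOdds_pWθ_le_half`, **`finiteOdds_mixingTime_le`**.

Reading (no numerics implied): the conjectured law-free order `(K/(σp))·log(K/ε)` of MEMO-gen36 §5 for the refresh-cycle chain of the lumped star, now a theorem (with `p̄` in
place of `p`; `p̄ ≥ p·min_v W_vθ_v ≥ p·min_v W_v/2`).  Literature grade (cell rule): OWN on the tree's LPW files (`mixingTime_le`); nothing cited as a fact; no new bib keys.
-/

open Finset Matrix
open Literature.Probability.MarkovChains

namespace Summit.Ventures.LatticeQCDFlow.Scaling

section Law
variable {X : Type*} [Fintype X] [DecidableEq X] {S : Type*} [Fintype S] [DecidableEq S]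
variable {hub : X → S} {comp : X → S → ℕ} {K : ℕ} {μ0 W θ : S → ℝ} {p σ ρ C c : ℝ} {acc : S → S → ℝ} {Kh : (S → ℕ) → S → S → ℝ}
variable {u ut : X → S → ℝ} {qt q : X → X → S → S → ℝ}
variable {P : X → X → ℝ} {Q : Matrix (X × X) (X × X) ℝ} {Δ : (S → ℕ) → (S → ℕ) → ℕ} {F Ψ : X × X → ℝ}
variable {NCf : X → X → S → ℕ} {af bf : X → X → S} {PXf PYf : X → X → Option S → Option S → ℝ} {xtf ytf xsf ysf : X → X → Option S → ℝ}

omit [Fintype S] [DecidableEq S] in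
/-- `p·W_v·θ_v = pW_v/(1+pW_v) ≤ ½` when `pW_v ≤ 1`. [ours] -/
theorem finiteOdds_pWθ_le_half (hp0 : 0 ≤ p) (hp : ∀ v, p * W v ≤ 1) (hW : ∀ v, 0 < W v) (hθ : ∀ v, θ v = 1 / (1 + p * W v)) (v : S) :
    p * (W v * θ v) ≤ 1 / 2 := by
  rw [hθ]
  have h1 : 0 < 1 + p * W v := by have := mul_nonneg hp0 (hW v).le; linarith
  rw [show p * (W v * (1 / (1 + p * W v))) = p * W v / (1 + p * W v) by ring, div_le_iff₀ h1]
  linarith [hp v]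

/-- **THE MIXING TIME AT SWAP ODDS `σ`:** setting of file 27 with `c = 2K+2`; if `0 < σ < 1` and `p̄ = pE_{μ_0}[Wθ] > 0` then for every `ε > 0`
`t_mix(ε) ≤ ⌈(1/(σp̄/(2K+2)))·log(((K+1)(4K+4) + 2(K+1)(4K+8))/ε)⌉₊`. [ours] -/
theorem finiteOdds_mixingTime_le [Nonempty X] (hinj : ∀ x x', hub x = hub x' → comp x = comp x' → x = x') (hsum : ∀ x, ∑ v, comp x v = K + 1)
    (hsurj : ∀ (z : S) (N : S → ℕ), ∑ v, N v = K + 1 → N z ≠ 0 → ∃ x, hub x = z ∧ comp x = N) (hhub : ∀ x, comp x (hub x) ≠ 0) (hK : 1 ≤ K)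
    (hW : ∀ v, 0 < W v) (hp0 : 0 ≤ p) (hp : ∀ v, p * W v ≤ 1) (hθ : ∀ v, θ v = 1 / (1 + p * W v)) (hacc : ∀ h v, acc h v = min 1 (W h / W v))
    (hμ0 : ∀ v, 0 ≤ μ0 v) (hμ1 : ∑ v, μ0 v = 1) (hσ0 : 0 < σ) (hσ1 : σ < 1) (hgap : 0 < p * ∑ v, μ0 v * (W v * θ v))
    (hKoff : ∀ N h v, h ≠ v → Kh N h v = if N h = 0 then 0 else (N v : ℝ) / K * acc h v) (hKdiag : ∀ N h, Kh N h h = 1 - ∑ v ∈ univ.erase h, Kh N h v)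
    (hu : ∀ x v, u x v = (1 - σ) * (if v = hub x then (1 : ℝ) else 0) + σ * ∑ h, u x h * Kh (comp x) h v)
    (hut : ∀ x v, ut x v = ∑ h, u x h * Kh (comp x) h v)
    (hqt : ∀ x y a b, qt x y a b = optimalCoupling (ut x) (ut y) a b)
    (hq : ∀ x y a b, q x y a b = (1 - σ) * ((if a = hub x then (1 : ℝ) else 0) * (if b = hub y then (1 : ℝ) else 0)) + σ * qt x y a b)
    (hΔ : ∀ N N', Δ N N' = ∑ v, (N v - N' v))
    (hP : ∀ x x', P x x' = ∑ a, u x a * (μ0 (hub x') * (if comp x' + Pi.single a 1 = comp x + Pi.single (hub x') 1 then (1 : ℝ) else 0)))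
    (hQ : ∀ x y x' y', Q (x, y) (x', y') = ∑ a, ∑ b, q x y a b * (μ0 (hub x')
      * (if comp x' + Pi.single a 1 = comp x + Pi.single (hub x') 1 then (1 : ℝ) else 0))
      * ((if hub y' = hub x' then (1 : ℝ) else 0) * (if comp y' + Pi.single b 1 = comp y + Pi.single (hub y') 1 then (1 : ℝ) else 0)))
    (hF : ∀ x y, F (x, y) = (2 * (K : ℝ) + 2) + (-(1 - σ) * θ (hub x)) + (-(1 - σ) * θ (hub y)) + ∑ v, θ v * ((comp x v : ℝ) + (comp y v : ℝ)))
    (hC : C = 2 * ((K + 1) * ((2 * (K : ℝ) + 2) + 2 * K + 6)))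
    (hΨ : ∀ x y, Ψ (x, y) = (Δ (comp x) (comp y) : ℝ) * F (x, y) + C * (if hub x = hub y then (0 : ℝ) else 1))
    -- the tagged data of every ORIENTED adjacent pair
    (horient : ∀ x y, hub x = hub y → Δ (comp x) (comp y) = 1 → W (bf x y) ≤ W (af x y) ∨ W (bf y x) ≤ W (af y x))
    (hcx : ∀ x y, hub x = hub y → Δ (comp x) (comp y) = 1 → W (bf x y) ≤ W (af x y) → comp x = NCf x y + Pi.single (af x y) 1)
    (hcy : ∀ x y, hub x = hub y → Δ (comp x) (comp y) = 1 → W (bf x y) ≤ W (af x y) → comp y = NCf x y + Pi.single (bf x y) 1)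
    (hPXoff : ∀ x y, hub x = hub y → Δ (comp x) (comp y) = 1 → W (bf x y) ≤ W (af x y) →
      ∀ h v, h ≠ v → PXf x y (some h) (some v) = if NCf x y h = 0 then 0 else (NCf x y v : ℝ) / K * acc h v)
    (hPXin : ∀ x y, hub x = hub y → Δ (comp x) (comp y) = 1 → W (bf x y) ≤ W (af x y) →
      ∀ h, PXf x y (some h) none = if NCf x y h = 0 then 0 else acc h (af x y) / K)
    (hPXdiag : ∀ x y, hub x = hub y → Δ (comp x) (comp y) = 1 → W (bf x y) ≤ W (af x y) →
      ∀ h, PXf x y (some h) (some h) = 1 - (∑ v ∈ univ.erase h, PXf x y (some h) (some v) + PXf x y (some h) none))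
    (hPXout : ∀ x y, hub x = hub y → Δ (comp x) (comp y) = 1 → W (bf x y) ≤ W (af x y) → ∀ v, PXf x y none (some v) = (NCf x y v : ℝ) / K * acc (af x y) v)
    (hPXstay : ∀ x y, hub x = hub y → Δ (comp x) (comp y) = 1 → W (bf x y) ≤ W (af x y) → PXf x y none none = 1 - ∑ v, PXf x y none (some v))
    (hPYoff : ∀ x y, hub x = hub y → Δ (comp x) (comp y) = 1 → W (bf x y) ≤ W (af x y) →
      ∀ h v, h ≠ v → PYf x y (some h) (some v) = if NCf x y h = 0 then 0 else (NCf x y v : ℝ) / K * acc h v)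
    (hPYin : ∀ x y, hub x = hub y → Δ (comp x) (comp y) = 1 → W (bf x y) ≤ W (af x y) →
      ∀ h, PYf x y (some h) none = if NCf x y h = 0 then 0 else acc h (bf x y) / K)
    (hPYdiag : ∀ x y, hub x = hub y → Δ (comp x) (comp y) = 1 → W (bf x y) ≤ W (af x y) →
      ∀ h, PYf x y (some h) (some h) = 1 - (∑ v ∈ univ.erase h, PYf x y (some h) (some v) + PYf x y (some h) none))
    (hPYout : ∀ x y, hub x = hub y → Δ (comp x) (comp y) = 1 → W (bf x y) ≤ W (af x y) → ∀ v, PYf x y none (some v) = (NCf x y v : ℝ) / K * acc (bf x y) v)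
    (hPYstay : ∀ x y, hub x = hub y → Δ (comp x) (comp y) = 1 → W (bf x y) ≤ W (af x y) → PYf x y none none = 1 - ∑ v, PYf x y none (some v))
    (hxtf : ∀ x y, hub x = hub y → Δ (comp x) (comp y) = 1 → W (bf x y) ≤ W (af x y) →
      ∀ t, xtf x y t = (1 - σ) * PXf x y (some (hub x)) t + σ * ∑ t', xtf x y t' * PXf x y t' t)
    (hytf : ∀ x y, hub x = hub y → Δ (comp x) (comp y) = 1 → W (bf x y) ≤ W (af x y) →
      ∀ t, ytf x y t = (1 - σ) * PYf x y (some (hub x)) t + σ * ∑ t', ytf x y t' * PYf x y t' t)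
    (hxsf : ∀ x y, hub x = hub y → Δ (comp x) (comp y) = 1 → W (bf x y) ≤ W (af x y) →
      ∀ t, xsf x y t = (1 - σ) * PXf x y none t + σ * ∑ t', xsf x y t' * PXf x y t' t)
    (hysf : ∀ x y, hub x = hub y → Δ (comp x) (comp y) = 1 → W (bf x y) ≤ W (af x y) →
      ∀ t, ysf x y t = (1 - σ) * PYf x y none t + σ * ∑ t', ysf x y t' * PYf x y t' t)
    {π : X → ℝ} (hπ : IsStationary π P) (hπ0 : ∀ x, 0 ≤ π x) (hπ1 : ∑ x, π x = 1) {ε : ℝ} (hε : 0 < ε) :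
    mixingTime P π ε ≤ ⌈1 / (σ * (p * ∑ v, μ0 v * (W v * θ v)) / (2 * K + 2)) * Real.log (((K + 1) * (4 * K + 4) + 2 * ((K + 1) * (4 * K + 8))) / ε)⌉₊ := by
  classical
  have hK0 : (0 : ℝ) < 2 * K + 2 := by positivity
  have hθ0 : ∀ v, 0 ≤ θ v := fun v => by rw [hθ]; have := mul_nonneg hp0 (hW v).le; positivity
  have hpbar : p * ∑ v, μ0 v * (W v * θ v) ≤ 1 / 2 := by
    calc p * ∑ v, μ0 v * (W v * θ v) = ∑ v, μ0 v * (p * (W v * θ v)) := by rw [mul_sum]; exact sum_congr rfl fun v _ => by ring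
      _ ≤ ∑ v, μ0 v * (1 / 2) := sum_le_sum fun v _ => mul_le_mul_of_nonneg_left (finiteOdds_pWθ_le_half hp0 hp hW hθ v) (hμ0 v)
      _ = 1 / 2 := by rw [← sum_mul, hμ1, one_mul]
  set ρ : ℝ := σ * (p * ∑ v, μ0 v * (W v * θ v)) / (2 * K + 2) with hρdef
  have hρ0 : 0 < ρ := div_pos (mul_pos hσ0 hgap) hK0
  have hρhalf : ρ ≤ 1 / 2 := by
    rw [hρdef, div_le_iff₀ hK0]
    have h2 : σ * (p * ∑ v, μ0 v * (W v * θ v)) ≤ 1 * (1 / 2) := mul_le_mul hσ1.le hpbar hgap.le zero_le_one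
    have hK1 : (1 : ℝ) ≤ K := by exact_mod_cast hK
    nlinarith
  have hρc : ρ * ((2 * (K : ℝ) + 2) + 2 * K + 2) ≤ 2 * σ * (p * ∑ v, μ0 v * (W v * θ v)) := by
    rw [hρdef]; apply le_of_eq; field_simp; ring
  have hlaw := finiteOdds_worstTvDist_le hinj hsum hsurj hhub hK hW hp0 hp hθ hacc hμ0 hμ1 (c := 2 * (K : ℝ) + 2) le_rfl hσ0.le hσ1 hρ0.le hρhalf hρc hKoff hKdiag hu hut hqt hq hΔ
    hP hQ hF hC hΨ horient hcx hcy hPXoff hPXin hPXdiag hPXout hPXstay hPYoff hPYin hPYdiag hPYout hPYstay hxtf hytf hxsf hysf hπ hπ0 hπ1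
  have hCpos : (0 : ℝ) < (K + 1) * (4 * K + 4) + 2 * ((K + 1) * (4 * K + 8)) := by positivity
  refine mixingTime_le _ _ ((hlaw _).trans ?_)
  have hCeq : ((K : ℝ) + 1) * ((2 * (K : ℝ) + 2) + 2 * K + 2) + 2 * ((K + 1) * ((2 * (K : ℝ) + 2) + 2 * K + 6))
      = (K + 1) * (4 * K + 4) + 2 * ((K + 1) * (4 * K + 8)) := by ring
  rw [hCeq]
  have hgeo : ∀ n : ℕ, (1 - ρ) ^ n ≤ Real.exp (-ρ * n) := by
    intro n
    have h1 : 1 - ρ ≤ Real.exp (-ρ) := by have := Real.add_one_le_exp (-ρ); linarith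
    have h0 : 0 ≤ 1 - ρ := by linarith
    calc (1 - ρ) ^ n ≤ (Real.exp (-ρ)) ^ n := pow_le_pow_left₀ h0 h1 _
      _ = Real.exp (-ρ * n) := by rw [← Real.exp_nat_mul]; ring_nf
  calc (((K : ℝ) + 1) * (4 * K + 4) + 2 * ((K + 1) * (4 * K + 8)))
        * (1 - ρ) ^ ⌈1 / ρ * Real.log (((K + 1) * (4 * K + 4) + 2 * ((K + 1) * (4 * K + 8))) / ε)⌉₊
      ≤ (((K : ℝ) + 1) * (4 * K + 4) + 2 * ((K + 1) * (4 * K + 8)))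
        * Real.exp (-ρ * (⌈1 / ρ * Real.log (((K + 1) * (4 * K + 4) + 2 * ((K + 1) * (4 * K + 8))) / ε)⌉₊ : ℕ)) := mul_le_mul_of_nonneg_left (hgeo _) hCpos.le
    _ ≤ ε := exp_le_of_ge_log hρ0 hCpos hε (Nat.le_ceil _)

end Law

end Summit.Ventures.LatticeQCDFlow.Scaling
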